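import Summits.AtomisticToContinuum.BoseEinsteinCondensation.Theses.BECInfraredBound
import Summits.AtomisticToContinuum.BoseEinsteinCondensation.Theorems.BECInfraredBoundAssembly
import Summits.AtomisticToContinuum.BoseEinsteinCondensation.Theorems.BECRieszReverseHolderGroundStateEnergyFinite
import Summits.AtomisticToContinuum.BoseEinsteinCondensation.Theorems.BECHardSphereReductionHardSphereBECStubSmoothSectors
import Summits.AtomisticToContinuum.BoseEinsteinCondensation.Theorems.BECHardSphereReductionHardSphereBECStubSectorTransferOf

/-!
# Rigidity-free positivity transfer: the zero-mode frame `X_B1` (and the conjunct) from MAJORITY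
# zero-mode condensation of the nonnegative near-minimisers — for every admissible interaction

Lead c8 of crux `HardSphereBEC` (stmt-11885), 2026-08-17; serves the summit's positivity routes
(`BECRieszReverseHolder` target `PositiveZeroMode` stmt-12839, `BECCellInformation`, `BECInsertionVariance`,
`BECInsertionCorrector`, `BECCutLineWeakDisorder`, …), all of which pass from NONNEGATIVE to ALL
near-minimisers through the shared crux `GroundStateRigidity` (stmt-9072; `PositivityTransfer`, stmt-12846).

The phase-sector transfer (`Cruxes.HardSphereBEC.Birth.stub_sectorTransfer_of`, p166621, with
`stub_sectorOccupation` p164230 and `stub_smoothSectors` p165003) makes that passage FREE as soon as the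
nonnegative zero-mode fraction exceeds `1/2`: split `Ψ` into the phase sectors `(Re Ψ)±, (Im Ψ)±`;
`occ₀(Ψ) + N ≥ 2 Σ_j occ₀(P_j)` slice-wise by "norm of a vector integral ≤ integral of the norm"; each
smoothed, normalised sector is again a near-minimiser (sum domination of energies and masses); so
`occ₀ ≥ cN` on nonnegative near-minimisers gives `occ₀ ≥ (c − 1/2)N` on all of them (sharp constant
`2c − 1`).  No uniqueness, positivity-improving or connectedness input; every `v : ℝ → ℝ≥0∞`.

* `becZeroModeThesis_of_majorityPositiveZeroMode` — **X_B1 (`BECInfraredBound.BecZeroModeThesis`,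
  stmt-0686's frame: zero-mode bound for ALL near-minimisers at small density) ⟸ the MAJORITY form of
  `PositiveZeroMode`** (`∃ c > 1/2` in place of `∃ c > 0`; Bogoliubov: `1 − O(√(ρa³))`), using only
  `groundStateEnergyFinite_proof` (Ruelle) for `E₀ < ⊤` eventually.
* `boseEinsteinCondensation_of_majorityPositiveZeroMode` — **the conjunct `BoseEinsteinCondensation` ⟸ the
  majority form of `PositiveZeroMode`** (`bec_of_zeroMode`).  For the planners (D-0014): a positivity route
  whose kernel delivers a nonnegative zero-mode fraction `> 1/2` needs neither `GroundStateRigidity` (9072)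
  nor `CubeConnected`.
-/

noncomputable section

namespace Summit.AtomisticToContinuum.BoseEinsteinCondensation.Theorems.MajorityPositivityTransfer

open MeasureTheory ENNReal Filter Literature.MathematicalPhysics.QuantumManyBody.BoseGas
open Summit.AtomisticToContinuum.BoseEinsteinCondensation.Theorems

/-- **X_B1 from majority positive zero-mode condensation, without rigidity**: if for every admissible `v`
and all small densities the NONNEGATIVE near-minimisers occupy the flat mode with a fraction `c > 1/2`
(eventually in `N`, at some slack), then ALL near-minimisers occupy it with the fraction `c − 1/2 > 0`
(`ρ₀ := min ρ₀ ρ₁^{fin}`; at each large `N`, `E₀ < ⊤` by `groundStateEnergyFinite_proof` and the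
phase-sector transfer `stub_sectorTransfer_of stub_sectorOccupation stub_smoothSectors` applies).
[folklore] -/
theorem becZeroModeThesis_of_majorityPositiveZeroMode
    (h : ∀ v : ℝ → ENNReal, Literature.MathematicalPhysics.QuantumManyBody.BoseGas.IsRepulsiveFiniteRange v → ∃ ρ₀ : ℝ, 0 < ρ₀ ∧ ∀ ρ : ℝ, 0 < ρ → ρ < ρ₀ → ∃ c : ℝ, 1 / 2 < c ∧ ∀ᶠ N : ℕ in Filter.atTop, ∃ δ : ENNReal, 0 < δ ∧ ∀ Ψ : Literature.MathematicalPhysics.QuantumManyBody.BoseGas.TrialState N (Literature.MathematicalPhysics.QuantumManyBody.BoseGas.sideLength ρ N), Literature.MathematicalPhysics.QuantumManyBody.BoseGas.energy v Ψ ≤ Literature.MathematicalPhysics.QuantumManyBody.BoseGas.groundStateEnergy v N (Literature.MathematicalPhysics.QuantumManyBody.BoseGas.sideLength ρ N) + δ → (∀ X, Ψ.ψ X = (‖Ψ.ψ X‖ : ℂ)) → ENNReal.ofReal (c * N) ≤ Literature.MathematicalPhysics.QuantumManyBody.BoseGas.occupation N ((Literature.MathematicalPhysics.QuantumManyBody.BoseGas.box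 (Literature.MathematicalPhysics.QuantumManyBody.BoseGas.sideLength ρ N)).indicator fun _ => ((Real.sqrt (Literature.MathematicalPhysics.QuantumManyBody.BoseGas.sideLength ρ N ^ 3))⁻¹ : ℂ)) Ψ.ψ) :
    Summit.AtomisticToContinuum.BoseEinsteinCondensation.Theses.BECInfraredBound.BecZeroModeThesis := by
  intro v hv
  obtain ⟨ρ₁, hρ₁, H1⟩ := groundStateEnergyFinite_proof v hv
  obtain ⟨ρ₂, hρ₂, H2⟩ := h v hv
  refine ⟨min ρ₁ ρ₂, lt_min hρ₁ hρ₂, fun ρ hρ hρlt => ?_⟩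
  have hρ1 : ρ < ρ₁ := hρlt.trans_le (min_le_left _ _)
  have hρ2 : ρ < ρ₂ := hρlt.trans_le (min_le_right _ _)
  obtain ⟨c, hc, hev⟩ := H2 ρ hρ hρ2
  refine ⟨c - 1 / 2, by linarith, ?_⟩
  filter_upwards [hev, H1 ρ hρ hρ1, eventually_gt_atTop 0] with N hN hE hN0
  obtain ⟨δ₁, hδ₁, hΦ⟩ := hN
  have hL : 0 < sideLength ρ N :=
    Real.rpow_pos_of_pos (div_pos (Nat.cast_pos.mpr hN0) hρ) _
  exact Cruxes.HardSphereBEC.Birth.stub_sectorTransfer_of Cruxes.HardSphereBEC.Birth.stub_sectorOccupation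
    Cruxes.HardSphereBEC.Birth.stub_smoothSectors _ N _ c δ₁ hc hL hE hδ₁ hΦ

/-- **The conjunct `BoseEinsteinCondensation` from majority positive zero-mode condensation** (no
rigidity): `bec_of_zeroMode ∘ becZeroModeThesis_of_majorityPositiveZeroMode`.
[cite: LSSY2005, §1.2 (1.17)–(1.19)] -/
theorem boseEinsteinCondensation_of_majorityPositiveZeroMode
    (h : ∀ v : ℝ → ENNReal, Literature.MathematicalPhysics.QuantumManyBody.BoseGas.IsRepulsiveFiniteRange v → ∃ ρ₀ : ℝ, 0 < ρ₀ ∧ ∀ ρ : ℝ, 0 < ρ → ρ < ρ₀ → ∃ c : ℝ, 1 / 2 < c ∧ ∀ᶠ N : ℕ in Filter.atTop, ∃ δ : ENNReal, 0 < δ ∧ ∀ Ψ : Literature.MathematicalPhysics.QuantumManyBody.BoseGas.TrialState N (Literature.MathematicalPhysics.QuantumManyBody.BoseGas.sideLength ρ N), Literature.MathematicalPhysics.QuantumManyBody.BoseGas.energy v Ψ ≤ Literature.MathematicalPhysics.QuantumManyBody.BoseGas.groundStateEnergy v N (Literature.MathematicalPhysics.QuantumManyBody.BoseGas.sideLength ρ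 N) + δ → (∀ X, Ψ.ψ X = (‖Ψ.ψ X‖ : ℂ)) → ENNReal.ofReal (c * N) ≤ Literature.MathematicalPhysics.QuantumManyBody.BoseGas.occupation N ((Literature.MathematicalPhysics.QuantumManyBody.BoseGas.box (Literature.MathematicalPhysics.QuantumManyBody.BoseGas.sideLength ρ N)).indicator fun _ => ((Real.sqrt (Literature.MathematicalPhysics.QuantumManyBody.BoseGas.sideLength ρ N ^ 3))⁻¹ : ℂ)) Ψ.ψ) :
    Literature.MathematicalPhysics.QuantumManyBody.BoseGas.BoseEinsteinCondensation :=
  _root_.AtomisticToContinuum.BECInfraredBound.bec_of_zeroMode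
    (becZeroModeThesis_of_majorityPositiveZeroMode h)

end Summit.AtomisticToContinuum.BoseEinsteinCondensation.Theorems.MajorityPositivityTransfer

end
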